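import Literature.NumberTheory.EllipticCurves.TateCurve.TorsionGaloisModule
import HarnessLib

/-!
# Crux `GoodLatticeBDPValue` (stmt-BirchSwinnertonDyer-19032), line `halves`, AN-3 Stub B road — brick F1:
# the level-3 ALGEBRA of a Tate basis (pure group theory, no field); level 9 in the sequel

Width seat bsd-line-x1-p1-w3 (gen 4). HONEST FRAMING (cell `bsd-eis`, run/shared/lean/pub/bsd-eis/):
TOOL THEOREMS ONLY (no `def`, no named fact, no `sorry`); nothing about a curve, a summit statement,
Keller–Yin Thm. 2.2.2 or crux 2 is proved here; 0 stubs / cells / labels move.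

WHY. The registered PRE stub `stub_anThreeTrivial` of `Cruxes/GoodLatticeBDPValue/Lines/halves.lean`
(AN-3: KY Thm. 2.2.2 at `p = 3`, `𝟙̃|_{G_K} = 𝟙`) factors (idea-11 g9,
`Lines/halves_anThree_typedSplit_idea11g9.lean`) through Stub B = Theorem T′
«`p = 3 → Good W 3 → Red W 3 → FullDescentDatumAt W 3`». The road memo
`HOME/line-x1-p1-w3-g4/AN3-StubB-elementary-road.md` (evidence #44 on the item) proves T′ by an
ELEMENTARY argument inside the Galois module `E[9]`; at a multiplicative prime `ℓ ≠ 3` every local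
input is read off the TATE BASIS of the `N`-torsion (`N = 3, 9`) supplied by the tree's THEOREM
`Literature.NumberTheory.EllipticCurves.TateCurve.exists_basis_of_uniformization` (with Tate's
uniformisation `TateCurve.Silverman1994_thmV53_corV54_tateUniformisation_holds`, DISCHARGED in the tree):
points `P₁ = Ψ(ζ_N)`, `P₂ = Ψ(q^{1/N})` generating the `N`-torsion with relations `N ∣ a ∧ N ∣ b` and a
triangular action `σ • P₁ = χ(σ) • P₁`, `σ • P₂ = P₂ + κ(σ) • P₁` (Silverman, *ATAEC* V §3, Lemma V.5.2).

This file is the PURE ALGEBRA over such a basis (a group `G` acting on an abelian group `M`; integers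
`χ σ`, `κ σ`), i.e. exactly the shape of that theorem's output, for `N = 3` and `N = 9`:

* §1 bookkeeping: `smul_comb` (the action on `a • P₁ + b • P₂`), `comb_eq_comb_iff` (coefficients are
  determined mod `N`), `smul_fst_eq_self_of_dvd` ((T-e): `σ` fixes `P₁` when `N ∣ χ σ − 1`, e.g. `σ` in
  the inertia group at `ℓ ∤ N`), `basis_three_of_basis_nine` (a level-9 basis gives the level-3 basis
  `(3P₁, 3P₂)` with the same `χ, κ`);
* §2 level 3 (memo L1/B1/A1): **`smul_eq_self_of_fixed_three`** (T-a) — if some `σ₀` has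
  `3 ∤ χ σ₀ − 1` (i.e. `ζ₃ ∉ ℚ_ℓ`, `ℓ ≡ 2 (mod 3)`) and the `3`-torsion has a NON-ZERO `G`-FIXED vector,
  then every `σ` with `3 ∣ χ σ − 1` (inertia) fixes the whole `3`-torsion («`q` is a cube», `3 ∣ v_ℓ(Δ)`);
  **`smul_eq_self_of_mem_of_card_eq_three`** (T-b) — such a `σ` fixes pointwise every `σ`-stable subgroup
  of order `3` (inertia acts unipotently, so stable lines are inertia-trivial: Lemma S′);
  **`eq_zmultiples_fst_of_smul_eq_chi_three`** (T-f) — a subgroup of order `3` on which `σ₀` acts as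
  the scalar `χ σ₀` IS `ℤ • P₁` (the `ω`-line is the Tate line);
* the level-9 statements (T-c), (T-d) (memo A2/A3) are the sequel file `…FullDescentTateAlgebraNine`.

References: [SilvermanATAEC1994] J. H. Silverman, *Advanced Topics in the Arithmetic of Elliptic Curves*,
GTM 151, Ch. V Thm. 3.1 (c),(d), Lemma 5.2 (c), Thm. 5.3 (PDF pp. 394–410); [SerreInventiones1972]
J.-P. Serre, Invent. Math. 15 (1972) §1.12 (the exact sequence `0 → μ_N → E_q[N] → ℤ/N → 0`).
-/

set_option autoImplicit false
set_option linter.dupNamespace false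

namespace Summit.BirchSwinnertonDyer.BirchSwinnertonDyer.Theorems.FullDescentTateAlgebra

variable {G M : Type*} [Group G] [AddCommGroup M] [DistribMulAction G M]

/-! ## §1. Bookkeeping in a Tate basis -/

/-- A distributive group action commutes with integer multiples. [folklore] -/
theorem smul_zsmul_comm (σ : G) (n : ℤ) (x : M) : σ • (n • x) = n • (σ • x) :=
  map_zsmul (DistribSMul.toAddMonoidHom M σ) n x

section Basis

variable {N : ℕ} {P₁ P₂ : M} {χ κ : G → ℤ}

/-- From the relations clause: `N • P₁ = 0`. [cite: SilvermanATAEC1994, Thm. V.3.1 (c)] -/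
theorem natCast_zsmul_fst_eq_zero
    (hrel : ∀ a b : ℤ, a • P₁ + b • P₂ = 0 ↔ ((N : ℕ) : ℤ) ∣ a ∧ ((N : ℕ) : ℤ) ∣ b) :
    ((N : ℕ) : ℤ) • P₁ = 0 := by
  have h := (hrel N 0).mpr ⟨dvd_rfl, dvd_zero _⟩
  simpa using h

/-- From the relations clause: `N • P₂ = 0`. [cite: SilvermanATAEC1994, Thm. V.3.1 (c)] -/
theorem natCast_zsmul_snd_eq_zero
    (hrel : ∀ a b : ℤ, a • P₁ + b • P₂ = 0 ↔ ((N : ℕ) : ℤ) ∣ a ∧ ((N : ℕ) : ℤ) ∣ b) :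
    ((N : ℕ) : ℤ) • P₂ = 0 := by
  have h := (hrel 0 N).mpr ⟨dvd_zero _, dvd_rfl⟩
  simpa using h

/-- From the relations clause: `P₁ ≠ 0` as soon as `N ≠ 1` (`N ∤ 1`). [folklore] -/
theorem fst_ne_zero
    (hrel : ∀ a b : ℤ, a • P₁ + b • P₂ = 0 ↔ ((N : ℕ) : ℤ) ∣ a ∧ ((N : ℕ) : ℤ) ∣ b)
    (hN : N ≠ 1) : P₁ ≠ 0 := by
  intro h0
  have h := (hrel 1 0).mp (by simp [h0])
  exact hN (by exact_mod_cast Int.eq_one_of_dvd_one (Int.natCast_nonneg N) h.1)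

/-- **The action in the Tate basis**: `σ • (a P₁ + b P₂) = (a χ(σ) + b κ(σ)) P₁ + b P₂`.
[cite: SilvermanATAEC1994, Lemma V.5.2 (proof: the matrix `((χ, κ), (0, 1))`)] -/
theorem smul_comb (hP₁ : ∀ σ : G, σ • P₁ = χ σ • P₁) (hP₂ : ∀ σ : G, σ • P₂ = P₂ + κ σ • P₁)
    (σ : G) (a b : ℤ) :
    σ • (a • P₁ + b • P₂) = (a * χ σ + b * κ σ) • P₁ + b • P₂ := by
  rw [smul_add, smul_zsmul_comm, smul_zsmul_comm, hP₁, hP₂]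
  module

/-- **Coefficients are determined mod `N`**: `a P₁ + b P₂ = a' P₁ + b' P₂ ↔ N ∣ a − a' ∧ N ∣ b − b'`.
[cite: SilvermanATAEC1994, Thm. V.3.1 (c),(d)] -/
theorem comb_eq_comb_iff
    (hrel : ∀ a b : ℤ, a • P₁ + b • P₂ = 0 ↔ ((N : ℕ) : ℤ) ∣ a ∧ ((N : ℕ) : ℤ) ∣ b)
    (a b a' b' : ℤ) :
    a • P₁ + b • P₂ = a' • P₁ + b' • P₂ ↔ ((N : ℕ) : ℤ) ∣ a - a' ∧ ((N : ℕ) : ℤ) ∣ b - b' := by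
  have h : a • P₁ + b • P₂ - (a' • P₁ + b' • P₂) = (a - a') • P₁ + (b - b') • P₂ := by module
  rw [← sub_eq_zero, h, hrel]

/-- **(T-e) `σ` fixes `P₁` whenever `N ∣ χ(σ) − 1`** (e.g. `σ` in the inertia group at a prime
`ℓ ∤ N`, where the cyclotomic character `χ = ε mod N` is unramified). [folklore] -/
theorem smul_fst_eq_self_of_dvd
    (hrel : ∀ a b : ℤ, a • P₁ + b • P₂ = 0 ↔ ((N : ℕ) : ℤ) ∣ a ∧ ((N : ℕ) : ℤ) ∣ b)
    (hP₁ : ∀ σ : G, σ • P₁ = χ σ • P₁) {σ : G} (hχ : ((N : ℕ) : ℤ) ∣ χ σ - 1) : σ • P₁ = P₁ := by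
  rw [hP₁]
  have h := (comb_eq_comb_iff hrel (χ σ) 0 1 0).mpr ⟨hχ, by simp⟩
  simpa using h

end Basis

/-- **A level-9 basis gives the level-3 basis `(3P₁, 3P₂)` with the same `χ, κ`.** [folklore] -/
theorem basis_three_of_basis_nine {P₁ P₂ : M} {χ κ : G → ℤ}
    (hgen : ∀ P : M, (9 : ℤ) • P = 0 → ∃ a b : ℤ, P = a • P₁ + b • P₂)
    (hrel : ∀ a b : ℤ, a • P₁ + b • P₂ = 0 ↔ (9 : ℤ) ∣ a ∧ (9 : ℤ) ∣ b)
    (hP₁ : ∀ σ : G, σ • P₁ = χ σ • P₁) (hP₂ : ∀ σ : G, σ • P₂ = P₂ + κ σ • P₁) :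
    (∀ P : M, (3 : ℤ) • P = 0 → ∃ a b : ℤ, P = a • ((3 : ℤ) • P₁) + b • ((3 : ℤ) • P₂)) ∧
    (∀ a b : ℤ, a • ((3 : ℤ) • P₁) + b • ((3 : ℤ) • P₂) = 0 ↔ (3 : ℤ) ∣ a ∧ (3 : ℤ) ∣ b) ∧
    (∀ σ : G, σ • ((3 : ℤ) • P₁) = χ σ • ((3 : ℤ) • P₁)) ∧
    (∀ σ : G, σ • ((3 : ℤ) • P₂) = (3 : ℤ) • P₂ + κ σ • ((3 : ℤ) • P₁)) := by
  refine ⟨fun P hP ↦ ?_, fun a b ↦ ?_, fun σ ↦ ?_, fun σ ↦ ?_⟩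
  · have hP9 : (9 : ℤ) • P = 0 := by
      rw [show (9 : ℤ) = 3 * 3 by norm_num, mul_smul, hP, smul_zero]
    obtain ⟨a, b, rfl⟩ := hgen P hP9
    have h3 : ((3 : ℤ) * a) • P₁ + ((3 : ℤ) * b) • P₂ = 0 := by
      rw [← hP]; module
    obtain ⟨ha, hb⟩ := (hrel _ _).mp h3
    obtain ⟨a', ha'⟩ : (3 : ℤ) ∣ a := by omega
    obtain ⟨b', hb'⟩ : (3 : ℤ) ∣ b := by omega
    exact ⟨a', b', by rw [ha', hb']; module⟩
  · have h : a • ((3 : ℤ) • P₁) + b • ((3 : ℤ) • P₂) = ((3 : ℤ) * a) • P₁ + ((3 : ℤ) * b) • P₂ := by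
      module
    rw [h, hrel]
    omega
  · rw [smul_zsmul_comm, hP₁]; module
  · rw [smul_zsmul_comm, hP₂]; module

/-! ## §2. Level 3 -/

section Three

variable {P₁ P₂ : M} {χ κ : G → ℤ}

/-- **(T-a) A non-zero fixed vector makes the inertia action trivial** (memo B1). If the `3`-torsion is
generated by a Tate basis `(P₁, P₂)`, some `σ₀` has `3 ∤ χ(σ₀) − 1` (so the Tate line `ℤ•P₁` carries a
non-trivial character: `ζ₃ ∉ ℚ_ℓ`, i.e. `ℓ ≡ 2 (mod 3)`), and some `P ≠ 0` of the `3`-torsion is fixed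
by ALL of `G`, then every `σ` with `3 ∣ χ(σ) − 1` (the inertia group) fixes the whole `3`-torsion:
`P = aP₁ + bP₂` must have `3 ∤ b`, and `σ P = P` forces `3 ∣ κ(σ)`. (For the Tate curve: a rational
`3`-torsion point off `Ψ(μ₃)` makes `q` a cube, so `E[3]` is unramified; Silverman *ATAEC* V.5.3, Ex. 5.11.)
[cite: SilvermanATAEC1994, Lemma V.5.2, Thm. V.5.3] -/
theorem smul_eq_self_of_fixed_three
    (hgen : ∀ P : M, (3 : ℤ) • P = 0 → ∃ a b : ℤ, P = a • P₁ + b • P₂)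
    (hrel : ∀ a b : ℤ, a • P₁ + b • P₂ = 0 ↔ (3 : ℤ) ∣ a ∧ (3 : ℤ) ∣ b)
    (hP₁ : ∀ σ : G, σ • P₁ = χ σ • P₁) (hP₂ : ∀ σ : G, σ • P₂ = P₂ + κ σ • P₁)
    {σ₀ : G} (hσ₀ : ¬ (3 : ℤ) ∣ χ σ₀ - 1)
    {P : M} (hP3 : (3 : ℤ) • P = 0) (hP0 : P ≠ 0) (hfix : ∀ σ : G, σ • P = P)
    {σ : G} (hχσ : (3 : ℤ) ∣ χ σ - 1) {x : M} (hx : (3 : ℤ) • x = 0) : σ • x = x := by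
  have hrel' : ∀ a b : ℤ, a • P₁ + b • P₂ = 0 ↔ ((3 : ℕ) : ℤ) ∣ a ∧ ((3 : ℕ) : ℤ) ∣ b := by
    simpa using hrel
  obtain ⟨a, b, rfl⟩ := hgen P hP3
  -- the coefficient constraint given by `τ • P = P`
  have hcoef : ∀ τ : G, (3 : ℤ) ∣ a * (χ τ - 1) + b * κ τ := by
    intro τ
    have h := hfix τ
    rw [smul_comb hP₁ hP₂] at h
    have h' := ((comb_eq_comb_iff hrel' _ _ _ _).mp h).1
    have e : a * χ τ + b * κ τ - a = a * (χ τ - 1) + b * κ τ := by ring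
    simpa [e] using h'
  -- `3 ∤ b`: otherwise `σ₀ • P = P` would force `3 ∣ a`, i.e. `P = 0`
  have hb : ¬ (3 : ℤ) ∣ b := by
    intro hb
    have h0 := hcoef σ₀
    have h1 : (3 : ℤ) ∣ a * (χ σ₀ - 1) := by
      have := dvd_sub h0 (Dvd.dvd.mul_right hb (κ σ₀))
      simpa using this
    have ha : (3 : ℤ) ∣ a := by
      rcases Int.prime_three.dvd_or_dvd h1 with h | h
      · exact h
      · exact absurd h hσ₀
    exact hP0 ((hrel a b).mpr ⟨ha, hb⟩)
  -- `σ • P = P` with `3 ∣ χ σ - 1` forces `3 ∣ κ σ`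
  have hκ : (3 : ℤ) ∣ κ σ := by
    have h0 := hcoef σ
    have h1 : (3 : ℤ) ∣ b * κ σ := by
      have := dvd_sub h0 (Dvd.dvd.mul_left hχσ a)
      simpa using this
    rcases Int.prime_three.dvd_or_dvd h1 with h | h
    · exact absurd h hb
    · exact h
  -- hence `σ` fixes every `3`-torsion element
  obtain ⟨a', b', rfl⟩ := hgen x hx
  rw [smul_comb hP₁ hP₂, comb_eq_comb_iff hrel']
  refine ⟨?_, by simp⟩
  have e : a' * χ σ + b' * κ σ - a' = a' * (χ σ - 1) + b' * κ σ := by ring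
  rw [show ((3 : ℕ) : ℤ) = 3 by norm_num, e]
  exact dvd_add (Dvd.dvd.mul_left hχσ a') (Dvd.dvd.mul_left hκ b')

/-- In an additive subgroup of prime order, every element is a multiple of any non-zero element.
[folklore] -/
theorem exists_zsmul_eq_of_card_eq_prime {p : ℕ} [hp : Fact p.Prime] {H : AddSubgroup M}
    (hH : Nat.card H = p) {y : M} (hy : y ∈ H) (hy0 : y ≠ 0) {x : M} (hx : x ∈ H) :
    ∃ m : ℤ, m • y = x := by
  have hy' : (⟨y, hy⟩ : H) ≠ 0 := fun h ↦ hy0 (by simpa using congrArg Subtype.val h)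
  have htop := zmultiples_eq_top_of_prime_card hH hy'
  have hx' : (⟨x, hx⟩ : H) ∈ AddSubgroup.zmultiples (⟨y, hy⟩ : H) := by rw [htop]; trivial
  obtain ⟨m, hm⟩ := AddSubgroup.mem_zmultiples_iff.mp hx'
  exact ⟨m, by simpa using congrArg Subtype.val hm⟩

/-- An element of an additive subgroup of order `3` is killed by `3`. [folklore] -/
theorem natCast_card_zsmul_eq_zero_of_mem {n : ℕ} {H : AddSubgroup M} (hH : Nat.card H = n) {x : M}
    (hx : x ∈ H) : (n : ℤ) • x = 0 := by
  have h : Nat.card H • (⟨x, hx⟩ : H) = 0 := card_nsmul_eq_zero'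
  rw [hH] at h
  have h' : n • x = 0 := by simpa using congrArg Subtype.val h
  rw [natCast_zsmul]
  exact h'

/-- **(T-b) Inertia fixes every stable line pointwise** (memo L1: the isogeny character is unramified
at a multiplicative `ℓ ≠ 3`). If `σ` has `3 ∣ χ(σ) − 1` (inertia) then `σ` acts unipotently on the
`3`-torsion (`σ x − x ∈ ℤ • P₁`, `σ P₁ = P₁`), hence trivially on every `σ`-stable subgroup of order `3`:
were `σ x − x = c P₁ ≠ 0` in `H`, then `H = ℤ • cP₁ ∋ x` would give `3 ∣ b` and `c ≡ 0`.
[cite: SilvermanATAEC1994, Lemma V.5.2] [cite: SerreInventiones1972, §1.12] -/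
theorem smul_eq_self_of_mem_of_card_eq_three
    (hgen : ∀ P : M, (3 : ℤ) • P = 0 → ∃ a b : ℤ, P = a • P₁ + b • P₂)
    (hrel : ∀ a b : ℤ, a • P₁ + b • P₂ = 0 ↔ (3 : ℤ) ∣ a ∧ (3 : ℤ) ∣ b)
    (hP₁ : ∀ σ : G, σ • P₁ = χ σ • P₁) (hP₂ : ∀ σ : G, σ • P₂ = P₂ + κ σ • P₁)
    {σ : G} (hχσ : (3 : ℤ) ∣ χ σ - 1) {H : AddSubgroup M} (hH : Nat.card H = 3)
    (hst : ∀ x ∈ H, σ • x ∈ H) {x : M} (hx : x ∈ H) : σ • x = x := by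
  haveI : Fact (Nat.Prime 3) := ⟨Nat.prime_three⟩
  have hrel' : ∀ a b : ℤ, a • P₁ + b • P₂ = 0 ↔ ((3 : ℕ) : ℤ) ∣ a ∧ ((3 : ℕ) : ℤ) ∣ b := by
    simpa using hrel
  have hx3 : (3 : ℤ) • x = 0 := by
    simpa using natCast_card_zsmul_eq_zero_of_mem hH hx
  obtain ⟨a, b, rfl⟩ := hgen x hx3
  -- `σ x - x = c • P₁` with `c = a (χ σ - 1) + b κ σ`
  set c : ℤ := a * (χ σ - 1) + b * κ σ with hc
  have hdiff : σ • (a • P₁ + b • P₂) - (a • P₁ + b • P₂) = c • P₁ := by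
    rw [smul_comb hP₁ hP₂, hc]; module
  have hmem : c • P₁ ∈ H := by
    rw [← hdiff]; exact H.sub_mem (hst _ hx) hx
  -- if `3 ∣ c` we are done
  by_cases h3c : (3 : ℤ) ∣ c
  · rw [← sub_eq_zero, hdiff]
    have h := (comb_eq_comb_iff hrel' c 0 0 0).mpr ⟨by simpa using h3c, by simp⟩
    simpa using h
  · -- otherwise `c • P₁` generates `H`, so `x` is a multiple of `P₁`: `3 ∣ b`, and then `3 ∣ c` after all
    exfalso
    have hc0 : c • P₁ ≠ 0 := by
      intro h0
      have h := (hrel c 0).mp (by simpa using h0)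
      exact h3c h.1
    obtain ⟨m, hm⟩ := exists_zsmul_eq_of_card_eq_prime hH hmem hc0 hx
    have hb : (3 : ℤ) ∣ b := by
      have h := (comb_eq_comb_iff hrel' (m * c) 0 a b).mp (by rw [← hm]; module)
      have := h.2
      simp only [Nat.cast_ofNat, zero_sub, dvd_neg] at this
      exact this
    apply h3c
    rw [hc]
    exact dvd_add (Dvd.dvd.mul_left hχσ a) (Dvd.dvd.mul_right hb _)

/-- **(T-f) The `ω`-line is the Tate line** (memo A1). A subgroup `H` of order `3` on which some `σ₀`
with `3 ∤ χ(σ₀) − 1` acts as the scalar `χ(σ₀)` is `ℤ • P₁`: for `x = aP₁ + bP₂ ∈ H`,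
`σ₀ x = χ(σ₀) x` gives `3 ∣ b (χ(σ₀) − 1)`, so `3 ∣ b`. [cite: SilvermanATAEC1994, Lemma V.5.2] -/
theorem eq_zmultiples_fst_of_smul_eq_chi_three
    (hgen : ∀ P : M, (3 : ℤ) • P = 0 → ∃ a b : ℤ, P = a • P₁ + b • P₂)
    (hrel : ∀ a b : ℤ, a • P₁ + b • P₂ = 0 ↔ (3 : ℤ) ∣ a ∧ (3 : ℤ) ∣ b)
    (hP₁ : ∀ σ : G, σ • P₁ = χ σ • P₁) (hP₂ : ∀ σ : G, σ • P₂ = P₂ + κ σ • P₁)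
    {σ₀ : G} (hσ₀ : ¬ (3 : ℤ) ∣ χ σ₀ - 1) {H : AddSubgroup M} (hH : Nat.card H = 3)
    (hact : ∀ x ∈ H, σ₀ • x = χ σ₀ • x) : H = AddSubgroup.zmultiples P₁ := by
  haveI : Fact (Nat.Prime 3) := ⟨Nat.prime_three⟩
  have hrel' : ∀ a b : ℤ, a • P₁ + b • P₂ = 0 ↔ ((3 : ℕ) : ℤ) ∣ a ∧ ((3 : ℕ) : ℤ) ∣ b := by
    simpa using hrel
  -- `H ≤ ℤ • P₁`
  have hle : H ≤ AddSubgroup.zmultiples P₁ := by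
    intro x hx
    have hx3 : (3 : ℤ) • x = 0 := by
      simpa using natCast_card_zsmul_eq_zero_of_mem hH hx
    obtain ⟨a, b, rfl⟩ := hgen x hx3
    have h := hact _ hx
    rw [smul_comb hP₁ hP₂, smul_add, smul_smul, smul_smul] at h
    have h' := ((comb_eq_comb_iff hrel' _ _ _ _).mp h).2
    have e : b - χ σ₀ * b = -(b * (χ σ₀ - 1)) := by ring
    rw [Nat.cast_ofNat, e, dvd_neg] at h'
    have hb : (3 : ℤ) ∣ b := by
      rcases Int.prime_three.dvd_or_dvd h' with h | h
      · exact h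
      · exact absurd h hσ₀
    have hx' : a • P₁ + b • P₂ = a • P₁ + (0 : ℤ) • P₂ :=
      (comb_eq_comb_iff hrel' _ _ _ _).mpr ⟨by simp, by simpa using hb⟩
    rw [hx', zero_smul, add_zero]
    exact AddSubgroup.zsmul_mem_zmultiples P₁ a
  -- and both have order `3`
  have hP₁0 : P₁ ≠ 0 := fst_ne_zero hrel' (by norm_num)
  have hP₁3 : (3 : ℕ) • P₁ = 0 := by
    rw [← natCast_zsmul]; simpa using natCast_zsmul_fst_eq_zero hrel'
  have hcard : Nat.card (AddSubgroup.zmultiples P₁) = 3 := by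
    rw [Nat.card_zmultiples, addOrderOf_eq_prime hP₁3 hP₁0]
  haveI : Finite (AddSubgroup.zmultiples P₁) := Nat.finite_of_card_ne_zero (by rw [hcard]; norm_num)
  exact AddSubgroup.eq_of_le_of_card_ge hle (by rw [hH, hcard])

end Three

end Summit.BirchSwinnertonDyer.BirchSwinnertonDyer.Theorems.FullDescentTateAlgebra
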